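import Mathlib.NumberTheory.NumberField.Units.DirichletTheorem
import Mathlib.RingTheory.DedekindDomain.AdicValuation
import Literature.AnabelianGeometry.EtaleTheta.LogDivisorModelTateTowerArithmeticGaussian

/-!
# [EtTh] Prop. 3.2 (iii) for every number field, and the arithmetic Tate tower datum of a Galois-fixed prime

S. Mochizuki, *The étale theta function …*, Publ. RIMS **45** (2009) [MochizukiEtTh2009], §3: Def. 3.1 / Prop. 3.2
(PRIMS PDF p.70; print PROVES assertion (iii) for `L` a finite extension of `ℚ_p` only — proof locus printed
p.297, "the well-known structure of `O_L^×`"; the NUMBER-FIELD case below is THIS FILE'S OWN EXTENSION, not a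
statement of the paper — doc-fix v3 per referee finding F-D15-12), Def. 3.3 (ii)–(iii) (p.73)
[cite: MochizukiEtTh2009, Prop 3.2 p.70].  abc-iut cell, seat abc-iut-w5-d223 gen 6, in-lineage sequel
«PROP32iii-NUMBERFIELD + DATUM-OF-FIXED-PRIME» to `LogDivisorModelTateTowerArithmeticGaussian.lean` (p470141: the
datum `Datum.gaussian` over `ℚ(i) = Frac ℤ[i]` at the inert prime `3`).  The two ingredients of that file that print
states in general are proved here in general:
* §A (any Dedekind domain `R`, `K = Frac R`): `DedekindDivisible.valuation_eq_one_of_forall_exists_pow_eq` — every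
  adic valuation of an infinitely divisible `c ∈ K^×` is `1`; `exists_isUnit_of_forall_valuation_eq_one`;
  **`exists_units_eq_of_forall_exists_pow_eq`** — such a `c` is a unit of `R` infinitely divisible IN `R^×`;
* §B **`NumberFieldDivisible.units_eq_one_of_forall_exists_pow_eq`: Prop. 3.2 (iii) holds for EVERY number field `K`**
  (`c ∈ K^×` with an `N`-th root for every `N ≥ 1` is `1`), via §A and Dirichlet's unit theorem
  (`NumberField.Units.exist_unique_eq_mul_prod`: the exponent vector of an infinitely divisible unit of `𝓞 K` on the
  fundamental system is divisible by every `N`, hence `0`; a torsion unit that is a `#torsion`-th power is `1`);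
* §C `DedekindDivisible.intValuation_eq_of_mem_imp` — adic valuations are invariant under ring automorphisms mapping
  the prime into itself (the decomposition-group clause); `TateTowerArith.restrictIntegers σ : 𝓞 L ≃+* 𝓞 L`;
  **`TateTowerArith.valuation_algEquiv_of_fixedPrime`** and the class (b) constructor
  **`TateTowerArith.Datum.ofFixedPrime : Datum K L`** for number fields `K ⊆ L`, a height-one prime `P ⊆ 𝓞 L`
  mapped into itself by every `σ ∈ Aut(L/K)`, and a `K`-rational `q` with `v_P(q) = exp(−1)` (fields `v_algEquiv`,
  `finiteDimensional`, `eq_one_of_divisible` all PROVED); `constGaloisLaw_ofFixedPrime`;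
* §D (v2 append) NON-VACUITY of the constructor: `RatIntegers.primeSpec p`, `Datum.ofFixedPrimeRat p : Datum ℚ ℚ`.
CLASS (b) constructor + classical lemmas print assumes; no new Prop-valued fact, no `instance`, no notation.
HONEST FRAMING: consistency/NV machinery for the typed [EtTh] §3 interfaces; nothing of [EtTh] asserted; nothing here
bears on [IUTchIII] Cor. 3.12; no side taken; typed ≠ proved.
-/

noncomputable section

namespace Literature.AnabelianGeometry.EtaleTheta

open IsDedekindDomain

/-! ### §A. Infinitely divisible elements of the fraction field of a Dedekind domain -/

namespace DedekindDivisible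

variable {R : Type*} [CommRing R] [IsDedekindDomain R] {K : Type*} [Field K] [Algebra R K] [IsFractionRing R K]

/-- In `ℤᵐ⁰`, a nonzero element admitting an `N`-th root for every `N ≥ 1` is `1`. [folklore] -/
private theorem withZero_eq_one_of_forall_exists_pow_eq {x : WithZero (Multiplicative ℤ)} (hx : x ≠ 0)
    (h : ∀ N : ℕ+, ∃ y : WithZero (Multiplicative ℤ), y ^ (N : ℕ) = x) : x = 1 := by
  obtain ⟨y, hy⟩ := h ⟨(WithZero.log x).natAbs + 1, Nat.succ_pos _⟩
  have hy0 : y ≠ 0 := by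
    rintro rfl
    rw [zero_pow (PNat.ne_zero _)] at hy
    exact hx hy.symm
  set m := WithZero.log x with hm
  have hlog : (((m.natAbs : ℕ) : ℤ) + 1) * WithZero.log y = m := by
    have h' := congrArg WithZero.log hy
    rw [WithZero.log_pow, PNat.mk_coe, nsmul_eq_mul, Nat.cast_add, Nat.cast_one] at h'
    exact h'
  rw [← WithZero.exp_log hx, WithZero.exp_eq_one]
  change m = 0
  refine Int.eq_zero_of_abs_lt_dvd ⟨WithZero.log y, hlog.symm⟩ ?_
  rw [← Int.natCast_natAbs]
  exact lt_add_one _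

/-- In `ℤᵐ⁰`, `x ^ N = 1` with `N ≥ 1` forces `x = 1`. [folklore] -/
private theorem withZero_eq_one_of_pow_eq_one {x : WithZero (Multiplicative ℤ)} {N : ℕ} (hN : N ≠ 0)
    (h : x ^ N = 1) : x = 1 := by
  have hx : x ≠ 0 := by
    rintro rfl
    rw [zero_pow hN] at h
    exact zero_ne_one h
  rw [← WithZero.exp_log hx] at h ⊢
  rw [← WithZero.exp_nsmul, WithZero.exp_eq_one, nsmul_eq_mul] at h
  rw [WithZero.exp_eq_one]
  rcases mul_eq_zero.mp h with h0 | h0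
  · exact absurd (by exact_mod_cast h0) hN
  · exact h0

/-- Every adic valuation of an infinitely divisible element of `K^×` (`K` the fraction field of a Dedekind domain
`R`) is `1`. [cite: MochizukiEtTh2009, Prop 3.2 p.70] -/
theorem valuation_eq_one_of_forall_exists_pow_eq (w : HeightOneSpectrum R) (c : Kˣ)
    (h : ∀ N : ℕ+, ∃ d : Kˣ, d ^ (N : ℕ) = c) : w.valuation K (c : K) = 1 := by
  refine withZero_eq_one_of_forall_exists_pow_eq ((Valuation.ne_zero_iff _).mpr c.ne_zero) fun N => ?_
  obtain ⟨d, hd⟩ := h N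
  exact ⟨w.valuation K (d : K), by rw [← map_pow, ← Units.val_pow_eq_pow_val, hd]⟩

/-- An element of `K^×` all of whose adic valuations are `1` is (the image of) a unit of the Dedekind domain `R`.
[cite: MochizukiEtTh2009, Prop 3.2 p.70] -/
theorem exists_isUnit_of_forall_valuation_eq_one (z : K) (hz : z ≠ 0)
    (h : ∀ w : HeightOneSpectrum R, w.valuation K z = 1) :
    ∃ e : R, IsUnit e ∧ algebraMap R K e = z := by
  obtain ⟨e, he⟩ := HeightOneSpectrum.mem_integers_of_valuation_le_one K z (fun w => (h w).le)
  obtain ⟨e', he'⟩ := HeightOneSpectrum.mem_integers_of_valuation_le_one K z⁻¹ (fun w => by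
    rw [map_inv₀, h w, inv_one])
  refine ⟨e, IsUnit.of_mul_eq_one e' (IsFractionRing.injective R K ?_), he⟩
  rw [map_mul, map_one]
  change (algebraMap R K) e * (algebraMap R K) e' = 1
  rw [he, he', mul_inv_cancel₀ hz]

/-- **An infinitely divisible element of `K^×` is a unit of `R` that is infinitely divisible IN `R^×`**
(all its roots have trivial adic valuations too). [cite: MochizukiEtTh2009, Prop 3.2 p.70] -/
theorem exists_units_eq_of_forall_exists_pow_eq (c : Kˣ) (h : ∀ N : ℕ+, ∃ d : Kˣ, d ^ (N : ℕ) = c) :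
    ∃ u : Rˣ, algebraMap R K u = c ∧ ∀ N : ℕ+, ∃ d : Rˣ, d ^ (N : ℕ) = u := by
  have hroot : ∀ N : ℕ+, ∀ d : Kˣ, d ^ (N : ℕ) = c →
      ∃ e : Rˣ, algebraMap R K e = d := by
    intro N d hd
    have hdval : ∀ w : HeightOneSpectrum R, w.valuation K (d : K) = 1 := by
      intro w
      have hc := valuation_eq_one_of_forall_exists_pow_eq w c h
      rw [← hd, Units.val_pow_eq_pow_val, map_pow] at hc
      exact withZero_eq_one_of_pow_eq_one (PNat.ne_zero N) hc
    obtain ⟨e, he, hed⟩ := exists_isUnit_of_forall_valuation_eq_one (d : K) d.ne_zero hdval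
    exact ⟨he.unit, hed⟩
  obtain ⟨c₁, hc₁⟩ := h 1
  rw [PNat.one_coe, pow_one] at hc₁
  obtain ⟨u, hu⟩ := hroot 1 c (by rw [PNat.one_coe, pow_one])
  refine ⟨u, hu, fun N => ?_⟩
  obtain ⟨d, hd⟩ := h N
  obtain ⟨e, he⟩ := hroot N d hd
  refine ⟨e, Units.ext (IsFractionRing.injective R K ?_)⟩
  rw [Units.val_pow_eq_pow_val, map_pow]
  change algebraMap R K (e : R) ^ (N : ℕ) = algebraMap R K (u : R)
  rw [he, hu, ← Units.val_pow_eq_pow_val, hd]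

end DedekindDivisible

/-! ### §B. Prop. 3.2 (iii) for every number field -/

namespace NumberFieldDivisible

open NumberField NumberField.Units

variable (K : Type*) [Field K] [NumberField K]

/-- A unit of `𝓞 K` infinitely divisible in `(𝓞 K)^×` is `1` (Dirichlet's unit theorem
`NumberField.Units.exist_unique_eq_mul_prod`: the exponent vector on the fundamental system of an infinitely divisible
unit is divisible by every `N`, hence `0`, so the unit is torsion; a torsion unit that is a `#torsion`-th power of a
unit is `1`). [cite: MochizukiEtTh2009, Prop 3.2 p.70] -/
theorem ringOfIntegers_units_eq_one_of_forall_exists_pow_eq (u : (𝓞 K)ˣ)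
    (h : ∀ N : ℕ+, ∃ d : (𝓞 K)ˣ, d ^ (N : ℕ) = u) : u = 1 := by
  classical
  -- Dirichlet: every unit is uniquely `ζ · ∏ fundSystem^f`; an `N`-th root multiplies the exponents by `N`
  have expo : ∀ (x d : (𝓞 K)ˣ) (N : ℕ), d ^ N = x →
      (exist_unique_eq_mul_prod K x).choose.2 = N • (exist_unique_eq_mul_prod K d).choose.2 := by
    intro x d N hdx
    obtain ⟨hd, -⟩ := (exist_unique_eq_mul_prod K d).choose_spec
    obtain ⟨-, huniq⟩ := (exist_unique_eq_mul_prod K x).choose_spec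
    set ζd := (exist_unique_eq_mul_prod K d).choose.1
    set fd := (exist_unique_eq_mul_prod K d).choose.2
    have hx : x = ((ζd ^ N : torsion K) : (𝓞 K)ˣ) * ∏ i, (fundSystem K i) ^ ((N • fd) i) := by
      rw [← hdx, hd, mul_pow, ← Finset.prod_pow, Subgroup.coe_pow]
      congr 1
      refine Finset.prod_congr rfl fun i _ => ?_
      rw [Pi.smul_apply, nsmul_eq_mul, ← zpow_natCast, ← zpow_mul, mul_comm]
    have := huniq ⟨ζd ^ N, N • fd⟩ hx
    exact (congrArg Prod.snd this).symm
  -- the exponent vector of `u` is divisible by every `N`, hence zero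
  set f := (exist_unique_eq_mul_prod K u).choose.2 with hf
  have hf0 : f = 0 := by
    funext i
    refine Int.eq_zero_of_abs_lt_dvd (m := ((f i).natAbs : ℤ) + 1) ?_ ?_
    · obtain ⟨d, hd⟩ := h ⟨(f i).natAbs + 1, Nat.succ_pos _⟩
      have he := expo u d _ hd
      rw [PNat.mk_coe] at he
      refine ⟨(exist_unique_eq_mul_prod K d).choose.2 i, ?_⟩
      have := congrFun he i
      rw [Pi.smul_apply, nsmul_eq_mul, Nat.cast_add, Nat.cast_one] at this
      exact this
    · rw [← Int.natCast_natAbs]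
      exact lt_add_one _
  -- so `u` is torsion
  have hu : u ∈ torsion K := by
    obtain ⟨hu', -⟩ := (exist_unique_eq_mul_prod K u).choose_spec
    rw [← hf, hf0] at hu'
    simp only [Pi.zero_apply, zpow_zero, Finset.prod_const_one, mul_one] at hu'
    rw [hu']
    exact SetLike.coe_mem _
  -- a `#torsion`-th root `d` of `u` has zero exponent vector, hence is torsion, hence `d ^ #torsion = 1`
  obtain ⟨d, hd⟩ := h ⟨torsionOrder K, torsionOrder_pos K⟩
  rw [PNat.mk_coe] at hd
  have hfd : (exist_unique_eq_mul_prod K d).choose.2 = 0 := by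
    have he := expo u d _ hd
    rw [← hf, hf0] at he
    funext i
    have := congrFun he i
    rw [Pi.zero_apply, Pi.smul_apply, nsmul_eq_mul] at this
    rcases mul_eq_zero.mp this.symm with h0 | h0
    · exact absurd (by exact_mod_cast h0) (torsionOrder_ne_zero K)
    · exact h0
  have hdt : d ∈ torsion K := by
    obtain ⟨hd', -⟩ := (exist_unique_eq_mul_prod K d).choose_spec
    rw [hfd] at hd'
    simp only [Pi.zero_apply, zpow_zero, Finset.prod_const_one, mul_one] at hd'
    rw [hd']
    exact SetLike.coe_mem _
  have hdpow : d ^ torsionOrder K = 1 := by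
    have := pow_card_eq_one' (G := torsion K) (x := ⟨d, hdt⟩)
    exact congrArg Subtype.val this
  rw [← hd, hdpow]

/-- **Prop. 3.2 (iii) for every number field**: an element of `K^×` admitting an `N`-th root for every `N ≥ 1` is `1`.
Print proves (iii) for `L` a finite extension of `ℚ_p` (printed p.297); the number-field analogue is this file's own
extension of that argument (F-D15-12: not a statement of the paper). [cite: MochizukiEtTh2009, Prop 3.2 p.70] -/
theorem units_eq_one_of_forall_exists_pow_eq (c : Kˣ) (h : ∀ N : ℕ+, ∃ d : Kˣ, d ^ (N : ℕ) = c) : c = 1 := by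
  obtain ⟨u, hu, hdiv⟩ := DedekindDivisible.exists_units_eq_of_forall_exists_pow_eq (R := 𝓞 K) c h
  have h1 := ringOfIntegers_units_eq_one_of_forall_exists_pow_eq K u hdiv
  apply Units.ext
  rw [← hu, h1, Units.val_one, map_one, Units.val_one]

end NumberFieldDivisible

/-! ### §C. Adic valuations under automorphisms fixing the prime; the datum of a Galois-fixed prime -/

namespace DedekindDivisible

variable {B : Type*} [CommRing B] [IsDedekindDomain B]

omit [IsDedekindDomain B] in
/-- A ring endomorphism mapping a height-one prime `P` into itself maps each power `Pⁿ` into itself. [folklore] -/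
private theorem mem_pow_of_mem_pow (P : HeightOneSpectrum B) (τ : B →+* B)
    (hτ : ∀ y ∈ P.asIdeal, τ y ∈ P.asIdeal) (n : ℕ) {y : B} (hy : y ∈ P.asIdeal ^ n) :
    τ y ∈ P.asIdeal ^ n := by
  have hle : Ideal.map τ (P.asIdeal ^ n) ≤ P.asIdeal ^ n := by
    rw [Ideal.map_pow]
    exact Ideal.pow_right_mono (Ideal.map_le_iff_le_comap.mpr fun z hz => hτ z hz) n
  exact hle (Ideal.mem_map_of_mem τ hy)

/-- **Adic valuations are invariant under automorphisms fixing the prime** (the decomposition-group clause): if ring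
endomorphisms `τ, ρ` of a Dedekind domain with `ρ ∘ τ = id` both map the height-one prime `P` into itself, then
`v_P ∘ τ = v_P` on `B`. [cite: MochizukiEtTh2009, Def 3.3 p.73] -/
theorem intValuation_eq_of_mem_imp (P : HeightOneSpectrum B) (τ ρ : B →+* B) (hρτ : ∀ y, ρ (τ y) = y)
    (hτ : ∀ y ∈ P.asIdeal, τ y ∈ P.asIdeal) (hρ : ∀ y ∈ P.asIdeal, ρ y ∈ P.asIdeal) (x : B) :
    P.intValuation (τ x) = P.intValuation x := by
  by_cases hx : x = 0
  · rw [hx, map_zero]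
  have hτx : τ x ≠ 0 := fun h0 => hx (by rw [← hρτ x, h0, map_zero])
  obtain ⟨c, hc⟩ : ∃ c : ℕ, P.intValuation x = WithZero.exp (-(c : ℤ)) := ⟨_, P.intValuation_if_neg hx⟩
  obtain ⟨c', hc'⟩ : ∃ c : ℕ, P.intValuation (τ x) = WithZero.exp (-(c : ℤ)) :=
    ⟨_, P.intValuation_if_neg hτx⟩
  have h1 : P.intValuation (τ x) ≤ WithZero.exp (-(c : ℤ)) := by
    rw [HeightOneSpectrum.intValuation_le_pow_iff_mem]
    exact mem_pow_of_mem_pow P τ hτ c ((HeightOneSpectrum.intValuation_le_pow_iff_mem P x c).mp hc.le)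
  have h2 : P.intValuation x ≤ WithZero.exp (-(c' : ℤ)) := by
    rw [HeightOneSpectrum.intValuation_le_pow_iff_mem, ← hρτ x]
    exact mem_pow_of_mem_pow P ρ hρ c' ((HeightOneSpectrum.intValuation_le_pow_iff_mem P (τ x) c').mp hc'.le)
  rw [hc'] at h1 ⊢
  rw [hc] at h2 ⊢
  rw [WithZero.exp_le_exp] at h1 h2
  rw [WithZero.exp_inj]
  omega

end DedekindDivisible

namespace LogDivisorModel.TateTowerArith

open NumberField

variable {K L : Type} [Field K] [NumberField K] [Field L] [NumberField L] [Algebra K L]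

/-- Restriction of `σ ∈ Aut(L/K)` to the ring of integers `𝓞 L`. [cite: MochizukiEtTh2009, Def 3.3 p.73] -/
def restrictIntegers (σ : L ≃ₐ[K] L) : 𝓞 L ≃+* 𝓞 L := RingOfIntegers.mapRingEquiv (σ : L ≃+* L)

omit [NumberField K] [NumberField L] in
/-- `restrictIntegers σ` is `σ` on `L`. [cite: MochizukiEtTh2009, Def 3.3 p.73] -/
theorem coe_restrictIntegers (σ : L ≃ₐ[K] L) (x : 𝓞 L) :
    ((restrictIntegers σ x : 𝓞 L) : L) = σ (x : L) := rfl

omit [NumberField K] in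
/-- **The valuation of a Galois-fixed prime is `Aut(L/K)`-invariant**: if every `σ ∈ Aut(L/K)` maps the height-one
prime `P ⊆ 𝓞 L` into itself, the `P`-adic valuation of `L` is invariant under every `σ`.
[cite: MochizukiEtTh2009, Def 3.3 p.73] -/
theorem valuation_algEquiv_of_fixedPrime (P : HeightOneSpectrum (𝓞 L))
    (hP : ∀ σ : L ≃ₐ[K] L, ∀ x ∈ P.asIdeal, restrictIntegers σ x ∈ P.asIdeal)
    (σ : L ≃ₐ[K] L) (z : L) : P.valuation L (σ z) = P.valuation L z := by
  have hint : ∀ x : 𝓞 L, P.intValuation (restrictIntegers σ x) = P.intValuation x :=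
    DedekindDivisible.intValuation_eq_of_mem_imp P (restrictIntegers σ : 𝓞 L →+* 𝓞 L)
      (restrictIntegers σ.symm : 𝓞 L →+* 𝓞 L)
      (fun y => RingOfIntegers.ext (by
        change σ.symm (σ (y : L)) = (y : L)
        exact σ.symm_apply_apply (y : L)))
      (hP σ) (hP σ.symm)
  obtain ⟨a, b, hb, rfl⟩ := IsFractionRing.div_surjective (A := 𝓞 L) z
  have ha : σ (algebraMap (𝓞 L) L a) = algebraMap (𝓞 L) L (restrictIntegers σ a) := rfl
  have hb' : σ (algebraMap (𝓞 L) L b) = algebraMap (𝓞 L) L (restrictIntegers σ b) := rfl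
  rw [map_div₀, ha, hb', map_div₀, map_div₀, HeightOneSpectrum.valuation_of_algebraMap,
    HeightOneSpectrum.valuation_of_algebraMap, HeightOneSpectrum.valuation_of_algebraMap,
    HeightOneSpectrum.valuation_of_algebraMap, hint, hint]

/-- **The arithmetic Tate tower datum of a Galois-fixed prime** (class (b) constructor): number fields `K ⊆ L`, a
height-one prime `P ⊆ 𝓞 L` mapped into itself by every `σ ∈ Aut(L/K)` (e.g. the unique prime over an inert
prime of `K`), and a `K`-rational `q` with `v_P(q) = exp(−1)` (so `P` is unramified over `K` with `q` a uniformizer)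
give a parameter record `Datum K L`; Prop. 3.2 (iii) for `L^×` is the number-field theorem of §B; the ℚ(i) datum
`Datum.gaussian` (p470141) is the same construction over `Frac ℤ[i]`.
[cite: MochizukiEtTh2009, Def 3.1 p.70] -/
def Datum.ofFixedPrime (P : HeightOneSpectrum (𝓞 L))
    (hP : ∀ σ : L ≃ₐ[K] L, ∀ x ∈ P.asIdeal, restrictIntegers σ x ∈ P.asIdeal)
    (q : K) (hq : P.valuation L (algebraMap K L q) = WithZero.exp (-1)) : Datum K L where
  v := P.valuation L
  finiteDimensional := inferInstance
  v_algEquiv := valuation_algEquiv_of_fixedPrime P hP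
  q := q
  v_q := hq
  eq_one_of_divisible := NumberFieldDivisible.units_eq_one_of_forall_exists_pow_eq L

/-- Every datum built this way enjoys the model file's Galois-correspondence law ([EtTh] Thm 3.7 (iii) binder) with
`Aut(L/K)` the full automorphism group of the number field extension. [cite: MochizukiEtTh2009, Thm 3.7 (iii) p.79] -/
theorem constGaloisLaw_ofFixedPrime (P : HeightOneSpectrum (𝓞 L))
    (hP : ∀ σ : L ≃ₐ[K] L, ∀ x ∈ P.asIdeal, restrictIntegers σ x ∈ P.asIdeal)
    (q : K) (hq : P.valuation L (algebraMap K L q) = WithZero.exp (-1)) :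
    (Datum.ofFixedPrime P hP q hq).action.ConstGaloisLaw :=
  (Datum.ofFixedPrime P hP q hq).constGaloisLaw

end LogDivisorModel.TateTowerArith

/-! ### §D. Non-vacuity of the constructor: `K = L = ℚ` at a rational prime -/

namespace RatIntegers

open NumberField IsDedekindDomain

/-- A rational prime is prime in `𝓞 ℚ ≅ ℤ`. [cite: MochizukiEtTh2009, Def 3.1 p.70] -/
theorem prime_natCast (p : ℕ) [hp : Fact p.Prime] : Prime (p : 𝓞 ℚ) := by
  have h : Prime (Rat.ringOfIntegersEquiv (p : 𝓞 ℚ)) := by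
    rw [map_natCast]
    exact Nat.prime_iff_prime_int.mp hp.out
  exact (MulEquiv.prime_iff Rat.ringOfIntegersEquiv.toMulEquiv).mp h

/-- The height-one prime `(p) ⊆ 𝓞 ℚ`. [cite: MochizukiEtTh2009, Def 3.1 p.70] -/
def primeSpec (p : ℕ) [Fact p.Prime] : HeightOneSpectrum (𝓞 ℚ) where
  asIdeal := Ideal.span {(p : 𝓞 ℚ)}
  isPrime := (Ideal.span_singleton_prime (prime_natCast p).ne_zero).mpr (prime_natCast p)
  ne_bot := by
    rw [Ne, Ideal.span_singleton_eq_bot]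
    exact (prime_natCast p).ne_zero

/-- `v_p(p) = exp(−1)` on `ℚ` for the `(p)`-adic valuation of `𝓞 ℚ` (the rational prime is a uniformizer).
[cite: MochizukiEtTh2009, Def 3.1 p.70] -/
theorem valuation_primeSpec_self (p : ℕ) [hp : Fact p.Prime] :
    (primeSpec p).valuation ℚ (p : ℚ) = WithZero.exp (-1) := by
  have hne : (p : 𝓞 ℚ) ≠ 0 := (prime_natCast p).ne_zero
  have hp' : (p : ℚ) = algebraMap (𝓞 ℚ) ℚ (p : 𝓞 ℚ) := by rw [map_natCast]
  rw [hp', HeightOneSpectrum.valuation_of_algebraMap]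
  obtain ⟨c, hc⟩ : ∃ c : ℕ, (primeSpec p).intValuation (p : 𝓞 ℚ) = WithZero.exp (-(c : ℤ)) :=
    ⟨_, (primeSpec p).intValuation_if_neg hne⟩
  have h1 : (primeSpec p).intValuation (p : 𝓞 ℚ) ≤ WithZero.exp (-((1 : ℕ) : ℤ)) := by
    rw [HeightOneSpectrum.intValuation_le_pow_iff_mem, pow_one]
    exact Ideal.mem_span_singleton_self _
  have h2 : ¬ (primeSpec p).intValuation (p : 𝓞 ℚ) ≤ WithZero.exp (-((2 : ℕ) : ℤ)) := by
    rw [HeightOneSpectrum.intValuation_le_pow_iff_mem]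
    change (p : 𝓞 ℚ) ∉ Ideal.span {(p : 𝓞 ℚ)} ^ 2
    rw [Ideal.span_singleton_pow, Ideal.mem_span_singleton]
    rintro ⟨x, hx⟩
    have hx' := congrArg Rat.ringOfIntegersEquiv hx
    rw [map_mul, map_pow, map_natCast] at hx'
    -- `p = p² · y` in `ℤ` is impossible for a prime `p`
    set y := Rat.ringOfIntegersEquiv x
    have hp0 : (p : ℤ) ≠ 0 := by exact_mod_cast hp.out.ne_zero
    have h1' : (1 : ℤ) = p * y := by
      have : (p : ℤ) * 1 = p * (p * y) := by rw [mul_one, ← mul_assoc, ← sq]; exact hx'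
      exact mul_left_cancel₀ hp0 this
    have hdvd : (p : ℤ) ∣ 1 := ⟨y, h1'⟩
    have := Int.eq_one_of_dvd_one (by exact_mod_cast hp.out.pos.le) hdvd
    exact hp.out.ne_one (by exact_mod_cast this)
  rw [hc] at h1 h2 ⊢
  rw [WithZero.exp_le_exp] at h1 h2
  push_cast at h1 h2
  have : (c : ℤ) = 1 := by omega
  rw [this]

end RatIntegers

namespace LogDivisorModel.TateTowerArith

open NumberField

/-- On `𝓞 ℚ` every `σ ∈ Aut(ℚ/ℚ)` restricts to the identity. [folklore] -/
private theorem restrictIntegers_rat (σ : ℚ ≃ₐ[ℚ] ℚ) (x : 𝓞 ℚ) : restrictIntegers σ x = x := by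
  apply RingOfIntegers.ext
  rw [coe_restrictIntegers]
  have h := σ.commutes (x : ℚ)
  rwa [Algebra.algebraMap_self_apply] at h

/-- **The constructor is inhabited**: `K = L = ℚ`, `P = (p)`, `q = p` (the lineage's `Datum.rat p`, rebuilt through
`Datum.ofFixedPrime`; `Aut(ℚ/ℚ)` fixes `(p)` trivially). [cite: MochizukiEtTh2009, Def 3.1 p.70] -/
def Datum.ofFixedPrimeRat (p : ℕ) [Fact p.Prime] : Datum ℚ ℚ :=
  Datum.ofFixedPrime (RatIntegers.primeSpec p) (fun σ x hx => by rwa [restrictIntegers_rat σ x]) (p : ℚ)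
    (by rw [Algebra.algebraMap_self_apply]; exact RatIntegers.valuation_primeSpec_self p)

/-- Hence the hypotheses of `Datum.ofFixedPrime` are jointly satisfiable. [cite: MochizukiEtTh2009, Def 3.1 p.70] -/
theorem nonempty_datum_ofFixedPrime : Nonempty (Datum ℚ ℚ) := ⟨Datum.ofFixedPrimeRat 2⟩

end LogDivisorModel.TateTowerArith

end Literature.AnabelianGeometry.EtaleTheta

end
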